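import Summits.QuantumFields.QCD.Theses.GapBuysCauchyRate
import Literature.MathematicalPhysics.QuantumFieldTheory.GaugeCovariantBlockMap

/-!
# Stub `stub_latticeExpSum` of line `birth` for crux `GapBuysCauchyRate.LadderCauchyRate`
(item stmt-QuantumFields-17307, route route-QuantumFields-GapBuysCauchyRate, sub-problem QCD)

What is proved: for every `μ > 0` there is `K` (explicitly `K = (2 e^{μ/2} / (μ/4))⁴`) such that
for all `0 < a ≤ 1`, all `y ∈ ℝ⁴` and all boxes `box 4 S' = {-S', …, S'}⁴ ⊆ ℤ⁴`,
`∑_{x ∈ box 4 S'} e^{-μ dist(a x, y)} ≤ K / a⁴` — a 4-d lattice of spacing `a` carries at most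
`K/a⁴` worth of exponential weight around any point, uniformly in the point and in the box.

How (elementary, Mathlib only):
* coordinates: `|a x_j - y_j| ≤ dist(a x, y)` (`PiLp.dist_apply_le`), hence with `c = μ/4`,
  `e^{-μ dist} ≤ ∏_{j : Fin 4} e^{-c |a x_j - y_j|}` (`Real.exp_sum`);
* the box is a `Fintype.piFinset`, so the sum of the product factorises into the product over the
  four coordinates of one-dimensional sums (`Finset.sum_prod_piFinset`);
* one-dimensional bound, uniform in the centre `y₀`: with `t₀ = ⌊y₀/a⌋` each term is at most
  `e^{ca} q^{|t - t₀|}`, `q = e^{-ca}`; splitting `t ≥ t₀` / `t < t₀` and reindexing injectively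
  into `ℕ` bounds each half by the geometric series `1/(1-q) ≤ e^{ca}/(ca)`
  (`geom_sum_Ico_le_of_lt_one`, `Real.add_one_le_exp`), giving
  `∑_{t ∈ s} e^{-c|a t - y₀|} ≤ 2 e^{c} e^{c} / (c a)` for any finite `s ⊆ ℤ`;
* assemble with `Finset.prod_le_prod` and `∏_{j : Fin 4} (M/a) = M⁴ / a⁴`.

Pure theorem file (no definitions): the registered stub signature, proved in tree vocabulary.
-/

noncomputable section

namespace Summit.QuantumFields.QCD.Cruxes.LadderCauchyRate.Birth

open scoped BigOperators Topology Classical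
open MeasureTheory Filter
open Literature.MathematicalPhysics.AQFT Literature.Probability.LatticeModels
  Literature.MathematicalPhysics.QuantumLattice Literature.MathematicalPhysics.QuantumFieldTheory
open Summit.QuantumFields.QCD.Theses.GapBuysCauchyRate

/-- Finite geometric sums over an arbitrary finite set of exponents: for `0 ≤ q < 1` and any finite
`u ⊆ ℕ`, `∑_{m ∈ u} q^m ≤ 1/(1-q)`. -/
private theorem geom_finset_le {q : ℝ} (hq : 0 ≤ q) (hq1 : q < 1) (u : Finset ℕ) :
    ∑ m ∈ u, q ^ m ≤ 1 / (1 - q) := by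
  calc ∑ m ∈ u, q ^ m ≤ ∑ m ∈ Finset.range (u.sup id).succ, q ^ m :=
        Finset.sum_le_sum_of_subset_of_nonneg (Finset.subset_range_sup_succ u)
          (fun _ _ _ => pow_nonneg hq _)
    _ ≤ q ^ 0 / (1 - q) := by
        rw [Finset.range_eq_Ico]
        exact geom_sum_Ico_le_of_lt_one hq hq1
    _ = 1 / (1 - q) := by rw [pow_zero]

/-- Reindexed geometric sums: if `g : ℤ → ℕ` is injective on the finite set `u ⊆ ℤ`, then
`∑_{t ∈ u} q^{g t} ≤ 1/(1-q)` for `0 ≤ q < 1`. -/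
private theorem geom_injOn_le {q : ℝ} (hq : 0 ≤ q) (hq1 : q < 1) (u : Finset ℤ) (g : ℤ → ℕ)
    (hg : Set.InjOn g u) : ∑ t ∈ u, q ^ g t ≤ 1 / (1 - q) := by
  calc ∑ t ∈ u, q ^ g t = ∑ m ∈ u.image g, q ^ m := (Finset.sum_image hg).symm
    _ ≤ 1 / (1 - q) := geom_finset_le hq hq1 _

/-- Two-sided discrete geometric sums: for `0 ≤ q < 1`, any centre `t₀ ∈ ℤ` and any finite
`s ⊆ ℤ`, `∑_{t ∈ s} q^{|t - t₀|} ≤ 2/(1-q)` (split into `t ≥ t₀` and `t < t₀`, on each of which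
`t ↦ |t - t₀|` is injective). -/
private theorem geom_natAbs_le {q : ℝ} (hq : 0 ≤ q) (hq1 : q < 1) (t₀ : ℤ) (s : Finset ℤ) :
    ∑ t ∈ s, q ^ (t - t₀).natAbs ≤ 2 / (1 - q) := by
  rw [← Finset.sum_filter_add_sum_filter_not s (fun t => t₀ ≤ t),
    show (2 : ℝ) / (1 - q) = 1 / (1 - q) + 1 / (1 - q) by ring]
  refine add_le_add (geom_injOn_le hq hq1 _ (fun t => (t - t₀).natAbs) ?_)
    (geom_injOn_le hq hq1 _ (fun t => (t - t₀).natAbs) ?_)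
  · intro x hx y hy hxy
    simp only [Finset.coe_filter, Set.mem_setOf_eq] at hx hy hxy
    omega
  · intro x hx y hy hxy
    simp only [Finset.coe_filter, Set.mem_setOf_eq] at hx hy hxy
    omega

/-- For `r > 0`, `1/(1 - e^{-r}) ≤ e^{r}/r`, a consequence of `1 + r ≤ e^{r}`. -/
private theorem one_div_one_sub_exp_neg_le {r : ℝ} (hr : 0 < r) :
    1 / (1 - Real.exp (-r)) ≤ Real.exp r / r := by
  have h1 : Real.exp (-r) < 1 := Real.exp_lt_one_iff.mpr (by linarith)
  have h2 : Real.exp (-r) * Real.exp r = 1 := by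
    rw [← Real.exp_add, neg_add_cancel, Real.exp_zero]
  have h3 : r + 1 ≤ Real.exp r := Real.add_one_le_exp r
  rw [div_le_div_iff₀ (by linarith) hr, one_mul]
  nlinarith [h2, h3]

/-- One-dimensional lattice exponential sum, uniform in the centre: for `c > 0`, `0 < a ≤ 1`,
`y₀ ∈ ℝ` and any finite `s ⊆ ℤ`, `∑_{t ∈ s} e^{-c |a t - y₀|} ≤ 2 e^{c} e^{c} / c / a`.
With `t₀ = ⌊y₀/a⌋` each term is at most `e^{ca} (e^{-ca})^{|t - t₀|}`, and the two-sided geometric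
sum is at most `2/(1 - e^{-ca}) ≤ 2 e^{ca}/(ca) ≤ 2 e^{c}/(ca)`. -/
private theorem sum_exp_abs_le {c a : ℝ} (hc : 0 < c) (ha : 0 < a) (ha1 : a ≤ 1) (y₀ : ℝ)
    (s : Finset ℤ) :
    ∑ t ∈ s, Real.exp (-(c * |a * t - y₀|)) ≤ 2 * Real.exp c * Real.exp c / c / a := by
  obtain ⟨t₀, ht₀⟩ : ∃ t₀ : ℤ, t₀ = ⌊y₀ / a⌋ := ⟨_, rfl⟩
  have hfl : (t₀ : ℝ) * a ≤ y₀ := (le_div_iff₀ ha).mp (ht₀ ▸ Int.floor_le _)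
  have hlt : y₀ < ((t₀ : ℝ) + 1) * a := (div_lt_iff₀ ha).mp (ht₀ ▸ Int.lt_floor_add_one _)
  have hca : 0 < c * a := mul_pos hc ha
  have hq0 : 0 ≤ Real.exp (-(c * a)) := (Real.exp_pos _).le
  have hq1 : Real.exp (-(c * a)) < 1 := Real.exp_lt_one_iff.mpr (by linarith)
  -- termwise comparison with a two-sided geometric progression centred at `t₀`
  have hterm : ∀ t : ℤ, Real.exp (-(c * |a * t - y₀|))
      ≤ Real.exp (c * a) * Real.exp (-(c * a)) ^ (t - t₀).natAbs := by
    intro t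
    rw [← Real.exp_nat_mul, ← Real.exp_add, Nat.cast_natAbs, Int.cast_abs, Int.cast_sub]
    apply Real.exp_le_exp.mpr
    have hkey : a * |(t : ℝ) - t₀| ≤ |a * t - y₀| + a := by
      have h3 : |y₀ - a * t₀| < a := by
        rw [abs_sub_lt_iff]
        constructor <;> linarith
      have h4 : a * |(t : ℝ) - t₀| = |a * t - a * t₀| := by
        rw [← mul_sub, abs_mul, abs_of_pos ha]
      rw [h4]
      linarith [abs_sub_le (a * t) y₀ (a * t₀)]
    have h5 := mul_le_mul_of_nonneg_left hkey hc.le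
    nlinarith [h5, abs_nonneg ((t : ℝ) - t₀), abs_nonneg (a * t - y₀)]
  have hE : Real.exp (c * a) ≤ Real.exp c := Real.exp_le_exp.mpr (by nlinarith)
  have hB : 1 / (1 - Real.exp (-(c * a))) ≤ Real.exp c / (c * a) :=
    (one_div_one_sub_exp_neg_le hca).trans (div_le_div_of_nonneg_right hE hca.le)
  have hpos : 0 ≤ 2 / (1 - Real.exp (-(c * a))) := div_nonneg zero_le_two (by linarith)
  calc ∑ t ∈ s, Real.exp (-(c * |a * t - y₀|))
      ≤ ∑ t ∈ s, Real.exp (c * a) * Real.exp (-(c * a)) ^ (t - t₀).natAbs :=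
        Finset.sum_le_sum fun t _ => hterm t
    _ = Real.exp (c * a) * ∑ t ∈ s, Real.exp (-(c * a)) ^ (t - t₀).natAbs := by
        rw [Finset.mul_sum]
    _ ≤ Real.exp (c * a) * (2 / (1 - Real.exp (-(c * a)))) :=
        mul_le_mul_of_nonneg_left (geom_natAbs_le hq0 hq1 t₀ s) (Real.exp_pos _).le
    _ ≤ Real.exp c * (2 / (1 - Real.exp (-(c * a)))) := mul_le_mul_of_nonneg_right hE hpos
    _ = Real.exp c * (2 * (1 / (1 - Real.exp (-(c * a))))) := by ring
    _ ≤ Real.exp c * (2 * (Real.exp c / (c * a))) := by gcongr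
    _ = 2 * Real.exp c * Real.exp c / c / a := by
        field_simp

/-- The 4-d estimate with decay rate written as `4 c`: for `c > 0`, `0 < a ≤ 1`, `y ∈ ℝ⁴` and any
box, `∑_{x ∈ box 4 S'} e^{-4c dist(a x, y)} ≤ (2 e^{c} e^{c} / c)⁴ / a⁴` (coordinatewise bound,
factorisation over `Fin 4`, and the one-dimensional lemma in each coordinate). -/
private theorem sum_box_exp_dist_le {c a : ℝ} (hc : 0 < c) (ha : 0 < a) (ha1 : a ≤ 1)
    (y : EuclideanSpace ℝ (Fin 4)) (S' : ℕ) :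
    ∑ x ∈ Literature.Probability.LatticeModels.box 4 S',
        Real.exp (-(4 * c * dist (a • siteToE x) y))
      ≤ (2 * Real.exp c * Real.exp c / c) ^ 4 / a ^ 4 := by
  -- termwise: `e^{-4c dist} ≤ ∏_j e^{-c |a x_j - y_j|}`
  have hterm : ∀ x : Site 4, Real.exp (-(4 * c * dist (a • siteToE x) y))
      ≤ ∏ j : Fin 4, Real.exp (-(c * |a * ((x j : ℤ) : ℝ) - y j|)) := by
    intro x
    rw [← Real.exp_sum]
    apply Real.exp_le_exp.mpr
    have hcoord : ∀ j : Fin 4, |a * ((x j : ℤ) : ℝ) - y j| ≤ dist (a • siteToE x) y := by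
      intro j
      have h := PiLp.dist_apply_le (a • siteToE x) y j
      simp only [PiLp.smul_apply, siteToE_apply, smul_eq_mul, Real.dist_eq] at h
      exact h
    calc -(4 * c * dist (a • siteToE x) y) = ∑ _j : Fin 4, -(c * dist (a • siteToE x) y) := by
          simp only [Finset.sum_const, Finset.card_univ, Fintype.card_fin, nsmul_eq_mul,
            Nat.cast_ofNat]
          ring
      _ ≤ ∑ j : Fin 4, -(c * |a * ((x j : ℤ) : ℝ) - y j|) :=
          Finset.sum_le_sum fun j _ => by
            have h := mul_le_mul_of_nonneg_left (hcoord j) hc.le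
            linarith
  calc ∑ x ∈ Literature.Probability.LatticeModels.box 4 S',
        Real.exp (-(4 * c * dist (a • siteToE x) y))
      ≤ ∑ x ∈ Literature.Probability.LatticeModels.box 4 S',
          ∏ j : Fin 4, Real.exp (-(c * |a * ((x j : ℤ) : ℝ) - y j|)) :=
        Finset.sum_le_sum fun x _ => hterm x
    _ = ∏ j : Fin 4, ∑ t ∈ Finset.Icc (-(S' : ℤ)) S', Real.exp (-(c * |a * (t : ℝ) - y j|)) := by
        rw [Literature.Probability.LatticeModels.box]
        exact Finset.sum_prod_piFinset _ (fun j (t : ℤ) => Real.exp (-(c * |a * (t : ℝ) - y j|)))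
    _ ≤ ∏ _j : Fin 4, 2 * Real.exp c * Real.exp c / c / a := by
        apply Finset.prod_le_prod
        · intro j _
          exact Finset.sum_nonneg fun t _ => (Real.exp_pos _).le
        · intro j _
          exact sum_exp_abs_le hc ha ha1 (y j) _
    _ = (2 * Real.exp c * Real.exp c / c) ^ 4 / a ^ 4 := by
        rw [Finset.prod_const, Finset.card_univ, Fintype.card_fin, div_pow]

/-- (S3a) **the 4-d lattice exponential sum** — size M, provable now (lead reshape r2: the counting
half of the summation lemma as its own registered stub).  For `μ > 0` there is `K` with
`Σ_{x ∈ box} e^{−μ dist(a·x, y)} ≤ K / a⁴` for all `0 < a ≤ 1`, all `y ∈ ℝ⁴` and all boxes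
(coordinatewise: `dist ≥ ¼ Σ_j |a x_j − y_j|`, the box sum factorises over the four coordinates, and
`Σ_{t ∈ ℤ} e^{−c |a t − y₀|} ≤ e^{c} (1 + 2/(c a))` for `a ≤ 1`). -/
theorem stub_latticeExpSum :
    ∀ μ : ℝ, 0 < μ → ∃ K : ℝ, ∀ a : ℝ, 0 < a → a ≤ 1 →
      ∀ (y : EuclideanSpace ℝ (Fin 4)) (S' : ℕ),
        ∑ x ∈ Literature.Probability.LatticeModels.box 4 S',
          Real.exp (-(μ * dist (a • siteToE x) y)) ≤ K / a ^ 4 := by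
  intro μ hμ
  refine ⟨(2 * Real.exp (μ / 4) * Real.exp (μ / 4) / (μ / 4)) ^ 4, fun a ha ha1 y S' => ?_⟩
  have h := sum_box_exp_dist_le (c := μ / 4) (by positivity) ha ha1 y S'
  rwa [show 4 * (μ / 4) = μ by ring] at h

end Summit.QuantumFields.QCD.Cruxes.LadderCauchyRate.Birth

end
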